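import Mathlib
import HarnessLib
import Summits.Ventures.LatticeQCDFlow.Scoring.GaussianPairSidak

/-!
# `J` CRITERIA LOADING ON ONE COMMON GAUSSIAN FACTOR PASS JOINTLY WITH PROBABILITY AT LEAST THE
# PRODUCT OF THEIR LEVELS: `∏_j P(|ρ_j Z₀ + τ_j Z_j| ≤ b_j) ≤ P(∀ j, |ρ_j Z₀ + τ_j Z_j| ≤ b_j)`

HONEST FRAMING: exact (Metropolis-corrected) sampling algorithms for lattice gauge theory;
figures of merit are autocorrelation/cost numbers at stated couplings and volumes; no
continuum-physics claim.

Venture `LatticeQCDFlow` (cell pub-lqcd), topic `Scoring`; FANOUT row 4 (`s0-u1-b`, GEN-35).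
NEW WORK of the cell (classical; our formalisation), no definition, nothing cited as a fact
(Dunn–Šidák one-factor inequalities NAMED ONLY).

WHY (row 4).  `Scoring/GaussianPairSidak` treats TWO criteria of one coupling.  A coupling's table
row may carry several observables (acceptance, `τ_int(Q)`, plaquette, …), each compared A-vs-B by a
symmetric window; in the simplest dependence model their studentised differences load on ONE common
Gaussian fluctuation `Z₀` plus independent noise: `Y_j = ρ_j Z₀ + τ_j Z_j`, `τ_j > 0`.  This file
proves, on `N(0,1) ⊗ N(0,1)^{⊗J}`, that `∏_j P(|Y_j| ≤ b_j) ≤ P(∀ j, |Y_j| ≤ b_j)`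
(**`gaussianOneFactor_prod_le_joint`**): conditionally on `Z₀ = t` the criteria are independent with
pass probabilities `g_j(t) = N(ρ_j t/τ_j, 1)([−b_j/τ_j, b_j/τ_j])`, all even and non-increasing in
`|t|`, and `Scoring/GaussianPairSidak.prod_integral_le_integral_prod_of_antitone_score` (iterated
Chebyshev) does the rest.  So per-criterion Šidák levels `L^{1/J}` are CONSERVATIVE for the row of a
single coupling under one-factor dependence, as they are exact under independence
(`Scoring/SimultaneousAgreementIndependentColumns`).

§2 adds the ONE-SIDED companion: with a non-negative loading `ρ ≥ 0`,
`P(X ≤ a)·P(Y ≤ b) ≤ P(X ≤ a ∧ Y ≤ b)` (**`gaussianPair_le_inter_ge_mul_of_nonneg`**, Slepian-type;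
same Chebyshev argument with the score `t` itself).

NOT CLAIMED: general covariance structures (Šidák 1967 / Royen 2014); the chain-level multivariate
CLT hook-up; numbers.
-/

open MeasureTheory ProbabilityTheory Filter Topology Finset

namespace Summit.Ventures.LatticeQCDFlow.Scoring

open Set

section OneFactor

variable {J : ℕ}

/-- Left sections of the joint event are boxes: for fixed `t`,
`N(0,1)^{⊗J}{w | ∀ j, |ρ_j t + τ_j w_j| ≤ b_j} = ∏_j N(0,1){x | |ρ_j t + τ_j x| ≤ b_j}`. [ours] -/
theorem pi_gaussianReal_forall_absLinear_le (ρ τ b : Fin J → ℝ) (t : ℝ) :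
    (Measure.pi fun _ : Fin J => gaussianReal 0 1).real
        {w : Fin J → ℝ | ∀ j, |ρ j * t + τ j * w j| ≤ b j}
      = ∏ j, (gaussianReal 0 1).real {x : ℝ | |ρ j * t + τ j * x| ≤ b j} := by
  have hset : {w : Fin J → ℝ | ∀ j, |ρ j * t + τ j * w j| ≤ b j}
      = Set.pi univ fun j => {x : ℝ | |ρ j * t + τ j * x| ≤ b j} := by
    ext w; simp
  rw [measureReal_def, hset, Measure.pi_pi, ENNReal.toReal_prod]
  rfl

/-- One criterion read on the product: `N(0,1)^{⊗J}{w | |ρ_j t + τ_j w_j| ≤ b_j} = N(0,1){x | |ρ_j t + τ_j x| ≤ b_j}`. -/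
theorem pi_gaussianReal_absLinear_le_eval (ρ τ b : Fin J → ℝ) (t : ℝ) (j : Fin J) :
    (Measure.pi fun _ : Fin J => gaussianReal 0 1).real
        {w : Fin J → ℝ | |ρ j * t + τ j * w j| ≤ b j}
      = (gaussianReal 0 1).real {x : ℝ | |ρ j * t + τ j * x| ≤ b j} := by
  have hA : MeasurableSet {x : ℝ | |ρ j * t + τ j * x| ≤ b j} :=
    measurableSet_le (by fun_prop) measurable_const
  rw [show {w : Fin J → ℝ | |ρ j * t + τ j * w j| ≤ b j}
      = (fun w : Fin J → ℝ => w j) ⁻¹' {x : ℝ | |ρ j * t + τ j * x| ≤ b j} from rfl,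
    measureReal_def, measureReal_def, ← Measure.map_apply (measurable_pi_apply j) hA,
    (measurePreserving_eval (fun _ : Fin J => gaussianReal 0 1) j).map_eq]

/-- **ONE-FACTOR ŠIDÁK.**  On `N(0,1) ⊗ N(0,1)^{⊗J}` with `Y_j(t, w) = ρ_j t + τ_j w_j`, `τ_j > 0`,
`b_j ≥ 0`:  `∏_j P(|Y_j| ≤ b_j) ≤ P(∀ j, |Y_j| ≤ b_j)`. [ours] -/
theorem gaussianOneFactor_prod_le_joint (ρ : Fin J → ℝ) {τ b : Fin J → ℝ} (hτ : ∀ j, 0 < τ j)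
    (hb : ∀ j, 0 ≤ b j) :
    ∏ j, ((gaussianReal 0 1).prod (Measure.pi fun _ : Fin J => gaussianReal 0 1)).real
        {p : ℝ × (Fin J → ℝ) | |ρ j * p.1 + τ j * p.2 j| ≤ b j}
      ≤ ((gaussianReal 0 1).prod (Measure.pi fun _ : Fin J => gaussianReal 0 1)).real
        {p : ℝ × (Fin J → ℝ) | ∀ j, |ρ j * p.1 + τ j * p.2 j| ≤ b j} := by
  set γ := gaussianReal 0 1 with hγ
  set Γ := Measure.pi fun _ : Fin J => gaussianReal 0 1 with hΓ
  set g : Fin J → ℝ → ℝ := fun j t => γ.real {x : ℝ | |ρ j * t + τ j * x| ≤ b j} with hg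
  -- measurability of the events
  have hlin : ∀ j, Measurable fun p : ℝ × (Fin J → ℝ) => |ρ j * p.1 + τ j * p.2 j| := fun j => by
    have : Measurable fun p : ℝ × (Fin J → ℝ) => p.2 j := (measurable_pi_apply j).comp measurable_snd
    fun_prop
  have hE : ∀ j, MeasurableSet {p : ℝ × (Fin J → ℝ) | |ρ j * p.1 + τ j * p.2 j| ≤ b j} :=
    fun j => measurableSet_le (hlin j) measurable_const
  have hAll : MeasurableSet {p : ℝ × (Fin J → ℝ) | ∀ j, |ρ j * p.1 + τ j * p.2 j| ≤ b j} := by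
    have : {p : ℝ × (Fin J → ℝ) | ∀ j, |ρ j * p.1 + τ j * p.2 j| ≤ b j}
        = ⋂ j, {p : ℝ × (Fin J → ℝ) | |ρ j * p.1 + τ j * p.2 j| ≤ b j} := by
      ext p; simp
    rw [this]
    exact MeasurableSet.iInter hE
  -- both sides as integrals over the common factor `t`
  have hmarg : ∀ j, (γ.prod Γ).real {p : ℝ × (Fin J → ℝ) | |ρ j * p.1 + τ j * p.2 j| ≤ b j}
      = ∫ t, g j t ∂γ := by
    intro j
    rw [measureReal_prod_eq_integral_left γ Γ (hE j)]
    refine integral_congr_ae (Eventually.of_forall fun t => ?_)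
    show Γ.real (Prod.mk t ⁻¹' {p : ℝ × (Fin J → ℝ) | |ρ j * p.1 + τ j * p.2 j| ≤ b j}) = g j t
    rw [show Prod.mk t ⁻¹' {p : ℝ × (Fin J → ℝ) | |ρ j * p.1 + τ j * p.2 j| ≤ b j}
      = {w : Fin J → ℝ | |ρ j * t + τ j * w j| ≤ b j} from rfl, hΓ,
      pi_gaussianReal_absLinear_le_eval ρ τ b t j]
  have hjoint : (γ.prod Γ).real {p : ℝ × (Fin J → ℝ) | ∀ j, |ρ j * p.1 + τ j * p.2 j| ≤ b j}
      = ∫ t, ∏ j, g j t ∂γ := by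
    rw [measureReal_prod_eq_integral_left γ Γ hAll]
    refine integral_congr_ae (Eventually.of_forall fun t => ?_)
    show Γ.real (Prod.mk t ⁻¹' {p : ℝ × (Fin J → ℝ) | ∀ j, |ρ j * p.1 + τ j * p.2 j| ≤ b j})
      = ∏ j, g j t
    rw [show Prod.mk t ⁻¹' {p : ℝ × (Fin J → ℝ) | ∀ j, |ρ j * p.1 + τ j * p.2 j| ≤ b j}
      = {w : Fin J → ℝ | ∀ j, |ρ j * t + τ j * w j| ≤ b j} from rfl, hΓ,
      pi_gaussianReal_forall_absLinear_le ρ τ b t]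
  simp only [hmarg, hjoint]
  -- the analytic core, score `|t|`
  have hgm : ∀ j, Measurable (g j) := fun j => by
    have hc : Continuous fun t : ℝ => (gaussianReal (ρ j * t / τ j) 1).real (Icc (-(b j / τ j)) (b j / τ j)) :=
      (continuous_gaussianReal_real_Icc_symm (div_nonneg (hb j) (hτ j).le)).comp (by fun_prop)
    have e : g j = fun t : ℝ => (gaussianReal (ρ j * t / τ j) 1).real (Icc (-(b j / τ j)) (b j / τ j)) := by
      funext t
      exact gaussianReal_real_absLinear_le (hτ j) (b j) t
    rw [e]
    exact hc.measurable
  exact prod_integral_le_integral_prod_of_antitone_score g (fun t : ℝ => |t|) hgm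
    (fun j t => measureReal_nonneg) (fun j t => measureReal_le_one)
    fun j x y hxy => gaussianReal_real_absLinear_le_anti (hτ j) (hb j) hxy

end OneFactor

/-! ## §2 One-sided criteria with a non-negative loading (Slepian-type, via Chebyshev) -/

section OneSided

/-- The section of a one-sided criterion: `N(0,1){w | ρt + τw ≤ b} = N(0,1)((−∞, (b − ρt)/τ])`
(`τ > 0`). [ours] -/
theorem gaussianReal_real_linear_le {ρ τ : ℝ} (hτ : 0 < τ) (b t : ℝ) :
    (gaussianReal 0 1).real {w : ℝ | ρ * t + τ * w ≤ b}
      = (gaussianReal 0 1).real (Iic ((b - ρ * t) / τ)) := by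
  congr 1
  ext w
  simp only [Set.mem_setOf_eq, Set.mem_Iic, le_div_iff₀ hτ]
  constructor <;> intro h <;> linarith

/-- **POSITIVE LOADING ⇒ POSITIVE ASSOCIATION OF ONE-SIDED CRITERIA.**  For the centred Gaussian pair
`(X, Y) = (Z₁, ρZ₁ + τZ₂)` with `ρ ≥ 0`, `τ > 0` and every `a, b`:
`P(X ≤ a)·P(Y ≤ b) ≤ P(X ≤ a ∧ Y ≤ b)` (Slepian's inequality for two variables, non-negative
correlation; both conditional pass probabilities are non-increasing in `t`). [ours] -/
theorem gaussianPair_le_inter_ge_mul_of_nonneg {ρ τ : ℝ} (hρ : 0 ≤ ρ) (hτ : 0 < τ) (a b : ℝ) :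
    (gaussianReal 0 1).real (Iic a)
        * ((gaussianReal 0 1).prod (gaussianReal 0 1)).real {p : ℝ × ℝ | ρ * p.1 + τ * p.2 ≤ b}
      ≤ ((gaussianReal 0 1).prod (gaussianReal 0 1)).real
        {p : ℝ × ℝ | p.1 ≤ a ∧ ρ * p.1 + τ * p.2 ≤ b} := by
  set γ := gaussianReal 0 1 with hγ
  set f : ℝ → ℝ := (Iic a).indicator (1 : ℝ → ℝ) with hf
  set g : ℝ → ℝ := fun t => γ.real {w : ℝ | ρ * t + τ * w ≤ b} with hg
  have hlin : Measurable fun p : ℝ × ℝ => ρ * p.1 + τ * p.2 := by fun_prop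
  have hB : MeasurableSet {p : ℝ × ℝ | ρ * p.1 + τ * p.2 ≤ b} := measurableSet_le hlin measurable_const
  have hA : MeasurableSet {p : ℝ × ℝ | p.1 ≤ a ∧ ρ * p.1 + τ * p.2 ≤ b} := by
    rw [Set.setOf_and]
    exact (measurableSet_le measurable_fst measurable_const).inter hB
  have h1 : γ.real (Iic a) = ∫ t, f t ∂γ := by
    rw [hf, integral_indicator_one measurableSet_Iic]
  have h2 : (γ.prod γ).real {p : ℝ × ℝ | ρ * p.1 + τ * p.2 ≤ b} = ∫ t, g t ∂γ := by
    rw [measureReal_prod_eq_integral_left γ γ hB]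
    rfl
  have h3 : (γ.prod γ).real {p : ℝ × ℝ | p.1 ≤ a ∧ ρ * p.1 + τ * p.2 ≤ b} = ∫ t, f t * g t ∂γ := by
    rw [measureReal_prod_eq_integral_left γ γ hA]
    refine integral_congr_ae (Eventually.of_forall fun t => ?_)
    show γ.real (Prod.mk t ⁻¹' {p : ℝ × ℝ | p.1 ≤ a ∧ ρ * p.1 + τ * p.2 ≤ b}) = f t * g t
    by_cases ht : t ≤ a
    · rw [hf, Set.indicator_of_mem (Set.mem_Iic.2 ht), Pi.one_apply, one_mul, hg]
      congr 1
      ext w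
      simp [ht]
    · rw [hf, Set.indicator_of_notMem (fun h => ht (Set.mem_Iic.1 h)), zero_mul]
      have : Prod.mk t ⁻¹' {p : ℝ × ℝ | p.1 ≤ a ∧ ρ * p.1 + τ * p.2 ≤ b} = ∅ := by
        ext w
        simp [ht]
      rw [this, measureReal_empty]
  rw [h1, h2, h3]
  have hfm : Measurable f := measurable_const.indicator measurableSet_Iic
  have hgm : Measurable g := by
    have e : g = fun t : ℝ => cdf γ ((b - ρ * t) / τ) := by
      funext t
      rw [hg]
      show γ.real {w : ℝ | ρ * t + τ * w ≤ b} = cdf γ ((b - ρ * t) / τ)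
      rw [gaussianReal_real_linear_le hτ, cdf_eq_real]
    rw [e]
    exact (monotone_cdf γ).measurable.comp (by fun_prop)
  have hfb : ∀ t, |f t| ≤ 1 := fun t => by
    simp only [hf, Set.indicator_apply]
    split_ifs <;> simp
  have hgb : ∀ t, |g t| ≤ 1 := fun t => by
    rw [hg, abs_of_nonneg measureReal_nonneg]
    exact measureReal_le_one
  -- both antitone in `t`
  have hf_anti : ∀ x y : ℝ, x ≤ y → f y ≤ f x := by
    intro x y hxy
    simp only [hf, Set.indicator_apply, Set.mem_Iic]
    by_cases hy : y ≤ a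
    · rw [if_pos hy, if_pos (hxy.trans hy), Pi.one_apply, Pi.one_apply]
    · rw [if_neg hy]
      split_ifs <;> norm_num
  have hg_anti : ∀ x y : ℝ, x ≤ y → g y ≤ g x := by
    intro x y hxy
    simp only [hg]
    rw [gaussianReal_real_linear_le hτ, gaussianReal_real_linear_le hτ]
    refine measureReal_mono (Iic_subset_Iic.2 ?_)
    exact div_le_div_of_nonneg_right (by nlinarith [mul_le_mul_of_nonneg_left hxy hρ]) hτ.le
  refine integral_mul_ge_of_comonotone hfm hgm hfb hgb fun x y => ?_
  rcases le_total x y with hxy | hxy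
  · have e1 := hf_anti x y hxy
    have e2 := hg_anti x y hxy
    exact mul_nonneg (by linarith) (by linarith)
  · have e1 := hf_anti y x hxy
    have e2 := hg_anti y x hxy
    exact mul_nonneg_of_nonpos_of_nonpos (by linarith) (by linarith)

end OneSided

end Summit.Ventures.LatticeQCDFlow.Scoring
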